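import Literature.Probability.RandomPlanarGeometry.HexSAWPolygonCellsOmegaDecode
import HarnessLib

/-!
# Cell calculus for honeycomb polygon surgery, XLIII: CASE 2 of THEOREM I read off the image — the leaf shapes (RU leaf, 3-chain) and the assembly

Topic `Literature/Probability/RandomPlanarGeometry` (lane «pcv-sawmu», a-p4 g23; sequel of XLII `…OmegaDecode` (`decode`, `lrunLen`, `rrunLen`, `walkIdx`,
`notMem_sdiff_of_case2`, `profile_insert_of_case2`, `profile_roof_of_case2`) and XLI `…OmegaPorts`).

CASE 2 of THEOREM I (THEOREM-OMEGA-g21 §4), continued: the two LEAF shapes of the base image at the top hexagon `w` — the RU leaf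
(`profile_ruLeaf_of_case2`: `S = W − w − {a_1..a_{k−1}}` with `t₀` read by the `R²`-walk from `c_j = LR w` and `k` by the `R`-run from `t₀`; `#W ≠ 4`;
`LL w ∉ W`, `L² (LR w) ∉ W`) and the 3-chain (`profile_chain3_of_case2`: `W = F₂`, `S` = the 3-chain below `w`, `#W = 4`) — and the assembly over the five
shapes of XLI `base_shapes`: ★★ `eq_decode_of_case2 : S = decode (ι S) w` and ★ `leaf_shape_of_case2` (a leaf top of CASE 2 has `LL w ∉ W` and
`L² (LR w) ∉ W`, incompatible with a ray top).

Sources: N. Madras, G. Slade, *The Self-Avoiding Walk* (1993), §3.2, proof of Theorem 3.2.3 pp. 64–65 [MadrasSlade1993]; I. Jensen, J. Phys.: Conf. Ser.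
42 (2006) 163, §2 [Jensen2006HoneycombPolygons].  Label (lane): LANE INFRASTRUCTURE for the lane's step-two injection (THEOREM I, CASE 2 readings);
nothing new in writing.
-/

open Finset

namespace Literature.Probability.RandomPlanarGeometry.SAW

namespace HexCell

section Case2

variable {S : Finset Cell} {w : Cell}

/-! ### The RU leaf: the base image is `B₀ ∪ roof t₀ k + UL c_j` over `B = B₀ + a_k` -/

/-- ★ **Shape RU-leaf in CASE 2.** With `B = B₀ + a_k` (`a_k = roofCell t₀ (k−1)`, `k ≥ 2`, run `e_0..e_{k−1} ⊆ B₀`, `e_k ∉ B₀`), `c = c_j` the chain hexagon,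
`L c ∉ B₀`, `C(B) = B₀ ∪ roof t₀ k + UL c` and `w = UL c`: `S = W − w − {a_1, …, a_{k−1}}`, the top is a LEAF, `#W ≠ 4`, the `R²`-walk from `LR w = c`
inside `W` ends at `t₀` after `j` steps, the `R`-run of `W` from `t₀` has `k` steps, and `LL w ∉ W`, `L² (LR w) ∉ W`.
[cite: MadrasSlade1993, §3.2 (proof of Theorem 3.2.3)] -/
theorem profile_ruLeaf_of_case2 (hS : IsBrickSet S) (hP : IsPolygon brickWallGraph (bdry S)) (h2 : 2 ≤ #(peel S))
    (hw : IsLexmax (omegaImage S) w) (hwC : w ∈ baseImage (peel S)) {t t₀ : Cell} {k j : ℕ} {B₀ : Finset Cell}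
    (het : topCell (peel S) = t) (ht₀ : IsLexmax B₀ t₀) (hk : 2 ≤ k) (hrun : ∀ i < k, runCell t₀ i ∈ B₀) (hend : runCell t₀ k ∉ B₀)
    (htk : t = roofCell t₀ (k - 1)) (hBeq : peel S = insert (roofCell t₀ (k - 1)) B₀) (hj : chainIdx B₀ t₀ = j)
    (hfl : L (chainCell t₀ j) ∉ B₀) (hI : baseImage (peel S) = ruLeafImage B₀ t₀ k) (hwc : w = UL (chainCell t₀ j)) :
    S = omegaImage S \ insert w (roof t₀ (k - 1)) ∧ ¬ 2 ≤ #(nbrs w ∩ omegaImage S) ∧ #(omegaImage S) ≠ 4 ∧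
      walkIdx (omegaImage S) (LR w) = j ∧ R^[2 * j] (LR w) = t₀ ∧ rrunLen (omegaImage S) t₀ = k ∧
      LL w ∉ omegaImage S ∧ L (L (LR w)) ∉ omegaImage S := by
  classical
  have hne : (peel S).Nonempty := card_pos.1 (by omega)
  have ht : IsLexmax (peel S) t := het ▸ isLexmax_topCell hne
  have hWeq := omegaImage_eq_of_case2 hS hP h2 hw hwC
  have hdisj := disjoint_baseImage_sdiff_of_case2 hS hP h2 hw hwC
  have hmemW : ∀ {x : Cell}, x ∈ omegaImage S ↔ x ∈ baseImage (peel S) ∨ x ∈ S \ peel S := fun {x} => by rw [hWeq, mem_union]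
  have hIW : baseImage (peel S) ⊆ omegaImage S := baseImage_subset_omegaImage S
  have hI' : baseImage (peel S) = insert (UL (chainCell t₀ j)) (B₀ ∪ roof t₀ k) := by rw [hI, ruLeafImage, hj]
  have hB₀W : ∀ {x : Cell}, x ∈ B₀ → x ∈ omegaImage S := fun hx => hIW (by rw [hI']; exact mem_insert_of_mem (mem_union_left _ hx))
  have hroofW : ∀ {x : Cell}, x ∈ roof t₀ k → x ∈ omegaImage S := fun hx => hIW (by rw [hI']; exact mem_insert_of_mem (mem_union_right _ hx))
  -- `L² c ∉ B₀` (the leaf condition of the chain stop)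
  have hLL2 : L (L (chainCell t₀ j)) ∉ B₀ := by
    rcases hj ▸ chainStop_chainIdx B₀ t₀ with h | h
    · exact absurd h hfl
    · exact h
  -- coordinates
  have hk1 : ((k - 1 : ℕ) : ℤ) = (k : ℤ) - 1 := by omega
  have ht1 : t.1 = t₀.1 + 2 * (k : ℤ) := by rw [htk, roofCell_fst, hk1]; ring
  have ht2 : t.2 = t₀.2 := by rw [htk, roofCell_snd]
  have hc1 : (chainCell t₀ j).1 = t₀.1 - 4 * (j : ℤ) := chainCell_fst _ _
  have hc2 : (chainCell t₀ j).2 = t₀.2 := chainCell_snd _ _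
  have hw1 : w.1 = t₀.1 - 4 * (j : ℤ) - 1 := by rw [hwc, UL_fst, hc1]
  have hw2 : w.2 = t₀.2 + 1 := by rw [hwc, UL_snd, hc2]
  have hLRw : LR w = chainCell t₀ j := Prod.ext (by simp [hw1]) (by simp [hw2])
  -- a hexagon outside `B₀`, off the apex row and off the roof abscissae is outside the base image
  have hnotI : ∀ x : Cell, x ∉ B₀ → x.2 ≠ t₀.2 + 1 → (x.1 < t₀.1 + 2 ∨ t₀.1 + 2 * (k : ℤ) + 2 ≤ x.1) → x ∉ baseImage (peel S) := by
    intro x hxB hrow hx hxI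
    rw [hI', mem_insert, mem_union] at hxI
    rcases hxI with rfl | hxI | hxI
    · simp at hrow
    · exact hxB hxI
    · obtain ⟨i, hi, rfl⟩ := mem_roof.1 hxI
      simp only [roofCell_fst] at hx; omega
  -- (1) `W = S ∪ A`, `A = {UL c} ∪ {a_1..a_{k-1}}` disjoint from `S`
  have hroof : roof t₀ k = insert (roofCell t₀ (k - 1)) (roof t₀ (k - 1)) := by
    conv_lhs => rw [show k = k - 1 + 1 by omega]
    exact roof_succ t₀ (k - 1)
  have hIA : baseImage (peel S) = peel S ∪ insert w (roof t₀ (k - 1)) := by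
    rw [hI', hBeq, hroof, hwc]; ext x; simp only [mem_insert, mem_union]; tauto
  have hWS : omegaImage S = S ∪ insert w (roof t₀ (k - 1)) := by
    rw [hWeq, hIA, union_right_comm, union_sdiff_of_subset (peel_subset S)]
  have hdisjA : Disjoint S (insert w (roof t₀ (k - 1))) := by
    rw [disjoint_right]
    intro x hxA hxS
    have hxI : x ∈ baseImage (peel S) := by rw [hIA]; exact mem_union_right _ hxA
    by_cases hxB : x ∈ peel S
    · rcases mem_insert.1 hxA with rfl | hxr
      · exact ht.notMem_of_row_lt (by rw [ht2, hw2]; omega) hxB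
      · obtain ⟨i, hi, rfl⟩ := mem_roof.1 hxr
        rw [hBeq, mem_insert] at hxB
        rcases hxB with e | hxB
        · have := roofCell_injective t₀ e; omega
        · exact ht₀.roofCell_notMem i hxB
    · exact (disjoint_left.1 hdisj) hxI (mem_sdiff.2 ⟨hxS, hxB⟩)
  -- (7) `LL w = L c ∉ W`
  have hLc : L (chainCell t₀ j) ∉ omegaImage S := by
    rw [hmemW, not_or]
    refine ⟨hnotI _ hfl (by simp) (Or.inl (by simp; omega)), ?_⟩
    refine notMem_sdiff_of_case2 hS hP h2 hw hwC het fun _ _ _ hrows => ?_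
    simp only [LL_fst, LL_snd, L_fst, L_snd, chainCell_fst, chainCell_snd, ht1, ht2] at hrows; omega
  have hLLw : LL w ∉ omegaImage S := by
    have e : LL w = L (chainCell t₀ j) := Prod.ext (by simp [hw1]; omega) (by simp [hw2])
    rw [e]; exact hLc
  -- `L w ∉ W`
  have hLw : L w ∉ omegaImage S := by
    rw [hmemW, not_or]
    constructor
    · intro h
      rw [hI] at h
      have := (rowProfile_ruLeafImage (k := k) ht₀ (L w) h).2 (by simp [hw2])
      simp [hw1, hj] at this
    · refine notMem_sdiff_of_case2 hS hP h2 hw hwC het fun h1 _ _ _ => ?_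
      rw [hBeq, mem_insert] at h1
      rcases h1 with e | h1
      · have := congrArg Prod.fst e; simp only [LL_fst, L_fst, roofCell_fst, hw1] at this; omega
      · apply hLL2
        have e : LL (L w) = L (L (chainCell t₀ j)) := Prod.ext (by simp [hw1]; omega) (by simp [hw2])
        rw [← e]; exact h1
  -- (8) `L² c ∉ W`
  have hLL2W : L (L (chainCell t₀ j)) ∉ omegaImage S := by
    rw [hmemW, not_or]
    refine ⟨hnotI _ hLL2 (by simp) (Or.inl (by simp; omega)), ?_⟩
    refine notMem_sdiff_of_case2 hS hP h2 hw hwC het fun _ _ _ hrows => ?_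
    simp only [LL_fst, LL_snd, L_fst, L_snd, chainCell_fst, chainCell_snd, ht1, ht2] at hrows; omega
  refine ⟨by rw [hWS, union_sdiff_cancel_right hdisjA], ?_, ?_, ?_, ?_, ?_, hLLw, by rw [hLRw]; exact hLL2W⟩
  · -- (2) the top is a leaf: its only present neighbour is `c = LR w`
    have hsub : nbrs w ∩ omegaImage S ⊆ {chainCell t₀ j} := by
      intro d hd
      obtain ⟨hdn, hdW⟩ := mem_inter.1 hd
      rw [mem_singleton]
      rw [mem_nbrs_iff] at hdn
      rcases hdn with rfl | rfl | rfl | rfl | rfl | rfl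
      · exact absurd hdW (by have e : ((w.1 - 1, w.2 - 1) : Cell) = LL w := rfl; rw [e]; exact hLLw)
      · exact Prod.ext (by simp [hw1]) (by simp [hw2])
      · exact absurd hdW (notMem_omegaImage_of_above hw (Or.inr ⟨rfl, by simp⟩))
      · exact absurd hdW (notMem_omegaImage_of_above hw (Or.inl (by simp)))
      · exact absurd hdW (notMem_omegaImage_of_above hw (Or.inl (by simp)))
      · exact absurd hdW (by have e : ((w.1 - 2, w.2) : Cell) = L w := rfl; rw [e]; exact hLw)
    have := card_le_card hsub
    rw [card_singleton] at this
    omega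
  · -- (3) `#W ≥ #C(B) = #B₀ + k + 1 ≥ 5`
    have hcardI : #(baseImage (peel S)) = #B₀ + k + 1 := by
      rw [hI', card_insert_of_notMem, card_union_roof_of_isLexmax ht₀]
      rw [mem_union, not_or]
      constructor
      · exact ht₀.notMem_of_row_lt (by simp)
      · intro h
        obtain ⟨i, -, hi⟩ := mem_roof.1 h
        have := congrArg Prod.snd hi; simp at this
    have h2B₀ : 2 ≤ #B₀ := by
      have hsub : ({t₀, runCell t₀ 0} : Finset Cell) ⊆ B₀ := by
        intro x hx
        rcases mem_insert.1 hx with rfl | hx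
        · exact ht₀.1
        · rw [mem_singleton] at hx; subst hx; exact hrun 0 (by omega)
      have hne' : t₀ ≠ runCell t₀ 0 := fun e => by have := congrArg Prod.snd e; simp only [runCell_snd] at this; omega
      have := card_le_card hsub
      rwa [card_pair hne'] at this
    have := card_le_card hIW
    omega
  · -- (4) the `R²`-walk from `c` stops at `t₀` after `j` steps
    rw [hLRw]
    have eR2 : ∀ i : ℕ, i ≤ j → R^[2 * i] (chainCell t₀ j) = chainCell t₀ (j - i) := by
      intro i hi
      rw [iterate_R]; ext <;> simp; push_cast [Nat.cast_sub hi]; ring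
    refine walkIdx_eq (fun i hi => ?_) (Or.inl ?_)
    · have e1 : R (R^[2 * i] (chainCell t₀ j)) = L (chainCell t₀ (j - i - 1)) := by
        rw [eR2 i hi.le]; exact Prod.ext (by simp; omega) (by simp)
      have e2 : R^[2 * i + 2] (chainCell t₀ j) = chainCell t₀ (j - i - 1) := by
        rw [show 2 * i + 2 = 2 * (i + 1) by ring, eR2 (i + 1) hi, show j - (i + 1) = j - i - 1 by omega]
      rw [e1, e2]
      refine ⟨?_, hB₀W (chainCell_mem ht₀.1 (by rw [hj]; omega))⟩
      rw [hmemW, not_or]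
      have hlt : j - i - 1 < chainIdx B₀ t₀ := by rw [hj]; omega
      refine ⟨hnotI _ (not_chainStop_of_lt hlt).1 (by simp) (Or.inl (by simp; omega)), ?_⟩
      refine notMem_sdiff_of_case2 hS hP h2 hw hwC het fun _ _ _ hrows => ?_
      simp only [LL_fst, LL_snd, L_fst, L_snd, chainCell_fst, chainCell_snd, ht1, ht2] at hrows; omega
    · rw [eR2 j le_rfl, Nat.sub_self, chainCell_zero]
      refine hroofW (mem_roof.2 ⟨0, by omega, ?_⟩)
      ext <;> simp
  · -- (5)
    rw [hLRw, iterate_R]; exact Prod.ext (by simp; omega) (by simp)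
  · -- (6) the `R`-run from `t₀`: `a_1, …, a_k ∈ W`, `a_{k+1} ∉ W`
    have eR : ∀ i : ℕ, R^[i + 1] t₀ = roofCell t₀ i := fun i => by rw [iterate_R]; ext <;> simp; ring
    refine rrunLen_eq (fun i hi => by rw [eR]; exact hroofW (mem_roof.2 ⟨i, hi, rfl⟩)) ?_
    rw [eR, hmemW, not_or]
    refine ⟨hnotI _ (ht₀.roofCell_notMem k) (by simp) (Or.inr (by simp)), ?_⟩
    refine notMem_sdiff_of_case2 hS hP h2 hw hwC het fun h1 _ _ _ => ?_
    rw [hBeq, mem_insert] at h1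
    rcases h1 with e | h1
    · have := congrArg Prod.snd e; simp at this
    · apply hend
      have e : LL (roofCell t₀ k) = runCell t₀ k := by ext <;> simp; ring
      rw [← e]; exact h1

/-! ### The 3-chain: the image is `F₂` -/

/-- ★ **The 3-chain in CASE 2**: no hexagon is peeled (the only host is the top, whose port lies above `F₂`), so `S = B = {p, UR p, UR² p}` and `W = F₂`;
the top `w = UL (UR p)` is a LEAF, `#W = 4`, `LL (LR w) = p`, and `LL w ∉ W`, `L² (LR w) ∉ W`. [cite: MadrasSlade1993, §3.2 (proof of Theorem 3.2.3)] -/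
theorem profile_chain3_of_case2 (hS : IsBrickSet S) (hP : IsPolygon brickWallGraph (bdry S)) (h2 : 2 ≤ #(peel S))
    (hw : IsLexmax (omegaImage S) w) (hwC : w ∈ baseImage (peel S)) {p : Cell} (eB : peel S = {p, UR p, UR (UR p)})
    (hI : baseImage (peel S) = {UL (UR p), UR p, R p, p}) (hwp : w = UL (UR p)) :
    S = {p, UR p, UR (UR p)} ∧ ¬ 2 ≤ #(nbrs w ∩ omegaImage S) ∧ #(omegaImage S) = 4 ∧ LL (LR w) = p ∧
      LL w ∉ omegaImage S ∧ L (L (LR w)) ∉ omegaImage S := by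
  classical
  have hWeq := omegaImage_eq_of_case2 hS hP h2 hw hwC
  -- nothing is peeled
  have hsd : S \ peel S = ∅ := by
    rw [eq_empty_iff_forall_notMem]
    intro m hm
    have hh := isHost_ll_of_case2 hS hP h2 hw hwC hm
    rw [eB, chain3_eq'] at hh
    have e := eq_top_of_isHost_chain3 hh
    have em : m = UR (UR (UR p)) := by rw [← ur_ll m, e]
    rcases lt_top_of_case2 hS hP h2 hw hwC hm with h | ⟨h, -⟩
    · rw [em, hwp] at h; simp at h
    · rw [em, hwp] at h; simp at h
  have hSB : S = peel S := Subset.antisymm (sdiff_eq_empty_iff_subset.1 hsd) (peel_subset S)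
  have hWF : omegaImage S = {UL (UR p), UR p, R p, p} := by rw [hWeq, hsd, union_empty, hI]
  have hw1 : w.1 = p.1 := by rw [hwp]; simp
  have hw2 : w.2 = p.2 + 2 := by rw [hwp]; simp; ring
  refine ⟨by rw [hSB, eB], ?_, ?_, by rw [hwp]; exact Prod.ext (by simp) (by simp), ?_, ?_⟩
  · -- the only present neighbour of `w` is `UR p = LR w`
    have hsub : nbrs w ∩ omegaImage S ⊆ {UR p} := by
      intro d hd
      obtain ⟨hdn, hdW⟩ := mem_inter.1 hd
      rw [mem_singleton]
      rw [hWF] at hdW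
      rw [mem_nbrs_iff, hw1, hw2] at hdn
      simp only [mem_insert, mem_singleton] at hdW
      rcases hdW with rfl | rfl | rfl | rfl
      · exfalso; rcases hdn with h | h | h | h | h | h <;>
          (have h1 := congrArg Prod.fst h; have h2 := congrArg Prod.snd h; simp only [UL_fst, UL_snd, UR_fst, UR_snd] at h1 h2; omega)
      · rfl
      · exfalso; rcases hdn with h | h | h | h | h | h <;>
          (have h1 := congrArg Prod.fst h; have h2 := congrArg Prod.snd h; simp only [R_fst, R_snd] at h1 h2; omega)
      · exfalso; rcases hdn with h | h | h | h | h | h <;>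
          (have h1 := congrArg Prod.fst h; have h2 := congrArg Prod.snd h; simp only at h1 h2; omega)
    have := card_le_card hsub
    rw [card_singleton] at this
    omega
  · rw [hWF, card_insert_of_notMem, card_insert_of_notMem, card_insert_of_notMem, card_singleton]
    · rw [mem_singleton]; intro h; have := congrArg Prod.fst h; simp at this
    · simp only [mem_insert, mem_singleton, not_or]
      exact ⟨fun h => by have := congrArg Prod.snd h; simp at this, fun h => by have := congrArg Prod.snd h; simp at this⟩
    · simp only [mem_insert, mem_singleton, not_or]
      exact ⟨fun h => by have := congrArg Prod.snd h; simp at this, fun h => by have := congrArg Prod.snd h; simp at this; omega,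
        fun h => by have := congrArg Prod.snd h; simp at this; omega⟩
  · rw [hWF]; simp only [mem_insert, mem_singleton, not_or, hwp]
    exact ⟨fun h => by have := congrArg Prod.fst h; simp at this, fun h => by have := congrArg Prod.fst h; simp at this; omega,
      fun h => by have := congrArg Prod.snd h; simp at this, fun h => by have := congrArg Prod.fst h; simp at this⟩
  · rw [hWF]; simp only [mem_insert, mem_singleton, not_or, hwp]
    exact ⟨fun h => by have := congrArg Prod.fst h; simp at this; omega, fun h => by have := congrArg Prod.fst h; simp at this; omega,
      fun h => by have := congrArg Prod.snd h; simp at this, fun h => by have := congrArg Prod.fst h; simp at this; omega⟩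

end Case2

/-! ### Assembly: `S = decode (ι S) w` in CASE 2, and the shape of a leaf top -/

section Assembly

variable {S : Finset Cell} {w : Cell}

/-- CASE 2, all shapes at once: `S = decode (ι S) w`, and a leaf top has `LL w ∉ W`, `L² (LR w) ∉ W`. [cite: MadrasSlade1993, §3.2 (proof of Theorem 3.2.3)] -/
theorem case2_readings (hS : IsBrickSet S) (hP : IsPolygon brickWallGraph (bdry S)) (h2 : 2 ≤ #(peel S))
    (hw : IsLexmax (omegaImage S) w) (hwC : w ∈ baseImage (peel S)) :
    S = decode (omegaImage S) w ∧ (¬ 2 ≤ #(nbrs w ∩ omegaImage S) → LL w ∉ omegaImage S ∧ L (L (LR w)) ∉ omegaImage S) := by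
  classical
  obtain ⟨hb, hpoly, hfix⟩ := peel_hyps hS hP
  have hne : (peel S).Nonempty := card_pos.1 (by omega)
  have ht := isLexmax_topCell hne
  have hwtop := eq_topCell_baseImage_of_case2 hw hwC
  rcases base_shapes hb hpoly h2 hfix with ⟨hL, eI, -, hmax⟩ | ⟨hL, -, eI, -, hk, hmax⟩ | ⟨p, eB, eI, -, -, hmax⟩ |
      ⟨t₀, k, ht₀, -, hk, hrun, hend, htop, hBeq, hsub⟩
  · -- class X
    have hwt : w = UL (topCell (peel S)) := by rw [hwtop, hmax.eq_topCell]
    have eLL : LL w = L (topCell (peel S)) := by rw [hwt]; exact Prod.ext (by simp only [LL_fst, UL_fst, L_fst]; ring) (by simp)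
    have eLR : LR w = topCell (peel S) := by rw [hwt]; exact Prod.ext (by simp) (by simp)
    obtain ⟨hSd, hthick, hLRw⟩ := profile_insert_of_case2 hS hP h2 hw hwC (by rw [eI, flipImage, hwt]) (by rw [hwt]; exact ht.ul_notMem)
      (by rw [eLL]; exact hL) (by rw [eLR]; exact ht.1)
    refine ⟨by rw [decode, if_pos hthick, if_pos hLRw]; exact hSd, fun h => absurd hthick h⟩
  · -- class R
    have hwt : w = roofCell (topCell (peel S)) (runLen (peel S) (topCell (peel S)) - 1) := by rw [hwtop, hmax.eq_topCell]
    obtain ⟨hSd, hthick, hLRw, hl, hLt⟩ := profile_roof_of_case2 hS hP h2 hw hwC rfl rfl hL hk (by rw [eI, roofImage]) hwt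
    refine ⟨?_, fun h => absurd hthick h⟩
    rw [decode, if_pos hthick, if_neg hLRw, hl, Nat.add_sub_cancel, hLt]; exact hSd
  · -- the 3-chain
    have hwt : w = UL (UR p) := by rw [hwtop, hmax.eq_topCell]
    obtain ⟨hSd, hleaf, h4, hp, h5, h6⟩ := profile_chain3_of_case2 hS hP h2 hw hwC eB eI hwt
    refine ⟨?_, fun _ => ⟨h5, h6⟩⟩
    rw [decode, if_neg hleaf, if_pos h4, hp]; exact hSd
  · rcases hsub with ⟨hfl, eI, -, hmax⟩ | ⟨hfl, eI, -, hmax⟩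
    · -- RU flip
      have hwt : w = UL (chainCell t₀ (chainIdx ((peel S).erase (topCell (peel S))) t₀)) := by rw [hwtop, hmax.eq_topCell]
      have hsubB : (peel S).erase (topCell (peel S)) ⊆ peel S := erase_subset _ _
      have eLL : LL w = L (chainCell t₀ (chainIdx ((peel S).erase (topCell (peel S))) t₀)) := by
        rw [hwt]; exact Prod.ext (by simp only [LL_fst, UL_fst, L_fst]; ring) (by simp)
      have eLR : LR w = chainCell t₀ (chainIdx ((peel S).erase (topCell (peel S))) t₀) := by rw [hwt]; exact Prod.ext (by simp) (by simp)
      obtain ⟨hSd, hthick, hLRw⟩ := profile_insert_of_case2 hS hP h2 hw hwC (by rw [eI, ruFlipImage, ← hBeq, hwt])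
        (by rw [hwt]; exact ht.notMem_of_row_lt (by rw [htop]; simp))
        (by rw [eLL]; exact hsubB hfl) (by rw [eLR]; exact hsubB (chainCell_mem ht₀.1 le_rfl))
      refine ⟨by rw [decode, if_pos hthick, if_pos hLRw]; exact hSd, fun h => absurd hthick h⟩
    · -- RU leaf
      have hwt : w = UL (chainCell t₀ (chainIdx ((peel S).erase (topCell (peel S))) t₀)) := by rw [hwtop, hmax.eq_topCell]
      obtain ⟨hSd, hleaf, h4, hwalk, ht₀', hrr, h7, h8⟩ :=
        profile_ruLeaf_of_case2 hS hP h2 hw hwC rfl ht₀ hk hrun hend htop hBeq rfl hfl eI hwt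
      refine ⟨?_, fun _ => ⟨h7, h8⟩⟩
      rw [decode, if_neg hleaf, if_neg h4, hwalk, ht₀', hrr]; exact hSd

/-- ★★ **THEOREM I, CASE 2 read off the image**: if the top hexagon `w` of `ι S` lies in the base image, then `S = decode (ι S) w`.
[cite: MadrasSlade1993, §3.2 (proof of Theorem 3.2.3)] -/
theorem eq_decode_of_case2 (hS : IsBrickSet S) (hP : IsPolygon brickWallGraph (bdry S)) (h2 : 2 ≤ #(peel S))
    (hw : IsLexmax (omegaImage S) w) (hwC : w ∈ baseImage (peel S)) : S = decode (omegaImage S) w :=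
  (case2_readings hS hP h2 hw hwC).1

/-- ★ **The shape of a leaf top in CASE 2**: if `w ∈ C(B)` has fewer than two contacts in `W` (the RU leaf or the 3-chain), then `LL w ∉ W` and
`L² (LR w) ∉ W` — incompatible with a ray top (whose contact is `LL w`, or `LR w` with `L² (LR w) ∈ W`). [cite: MadrasSlade1993, §3.2 (proof of Theorem 3.2.3)] -/
theorem leaf_shape_of_case2 (hS : IsBrickSet S) (hP : IsPolygon brickWallGraph (bdry S)) (h2 : 2 ≤ #(peel S))
    (hw : IsLexmax (omegaImage S) w) (hwC : w ∈ baseImage (peel S)) (hleaf : ¬ 2 ≤ #(nbrs w ∩ omegaImage S)) :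
    LL w ∉ omegaImage S ∧ L (L (LR w)) ∉ omegaImage S :=
  (case2_readings hS hP h2 hw hwC).2 hleaf

end Assembly

end HexCell

end Literature.Probability.RandomPlanarGeometry.SAW
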